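import Summits.Ventures.Crystal3D.Theorems.StickyWulffConstantCoaxialWallLawSeamEndBallRigidity
import Summits.Ventures.Crystal3D.Theorems.StickyWulffConstantCoaxialWallLawSaturatedReaders
import HarnessLib

/-!
# A FULL-reader (A)-end ball has at most ELEVEN contacts (E1; no certificate beyond `P5Exhaustion`)
# (crux `CoaxialWallLaw`, stmt-Ventures-19481; lane F 'Certificates' v8.3R, registered stub `stub_threePayer`, (L2) reader-type split '…SeamThreePayerSplit')

HONEST FRAMING. Venture `Summits/Ventures/Crystal3D` (cell `crystal3d-full`); helper for `stub_threePayer`.  CONDITIONAL on the registered computational fact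
`P5Exhaustion` (`stub_E1`).  END-BALL RIGIDITY ('…SeamEndBallRigidity', no E1) says a saturated (A)-end ball has a NON-arranged shell, so the deg-12 case of
`ThreePayer` needs `SatCensus12` (= the one-free-pair certificate G12′).  THIS FILE removes the deg-12 case ENTIRELY at FULL-reader ends, using E1: the end ball
`b = q + G u` of a FULL reader `q` carries the closed slot star of `−u` (`q` and the four common neighbours of `b` and `q`, all from `q`'s complete dozen), so if `b`
were saturated its shell would be the slot dozen — `b` FULL, hence moving — or a twin dozen keeping the star on the own side — `b` TWIN-READING with
`⟪G u, n⟫ ∈ {0, √(2/3)}`, hence moving (`shell_slots_or_twin_of_star_twelve`, '…SaturatedStar'); an END ball is not moving.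
* `star_occupied_of_full_reader` — the closed star of `−u` at `b` is occupied;
* `slot_ne_mirror` — a slot ball position is never a mirror position of a twin dozen;
* **`card_contacts_le_eleven_of_full_end : P5Exhaustion → … → IsFull X G q → b = q + G u → ¬ IsMoving X v G (G u) b → #contacts(b) ≤ 11`**;
* **`card_contacts_le_eleven_of_isEndPairA_full`** — the same from the data of `IsEndPairA` in its FULL branch: with E1, the (L2) split needs `SatCensus12` only at
  NARROW / GLIDE ends (CROSS ends are alike in the mirrored frame; not done here).
WHAT THIS IS NOT: nothing about deg-11 ends (that is `SatCensus11Full`, finite but certificate-laden); F-C1 not moved.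
-/

noncomputable section

namespace Summit.Ventures.Crystal3D.Theorems

namespace TailResidue

open Summit.Ventures.Crystal3D Finset
open scoped InnerProductSpace

variable {X : Finset (EuclideanSpace ℝ (Fin 3))}

/-- A slot at positive inner product with the slot `δ` is `δ` itself or a neighbour of it (`⟪w, δ⟫ = ½`). -/
theorem eq_or_inner_eq_half_of_inner_pos {w δ : EuclideanSpace ℝ (Fin 3)} (hw : w ∈ fccSlots) (hδ : δ ∈ fccSlots) (h : 0 < ⟪w, δ⟫_ℝ) :
    w = δ ∨ ⟪w, δ⟫_ℝ = 1 / 2 := by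
  rcases inner_slots_mem hw hδ with e | e | e | e | e
  · exact Or.inl (eq_of_inner_eq_one hw hδ e).symm
  · exact Or.inr e
  · rw [e] at h; exact absurd h (lt_irrefl 0)
  · rw [e] at h; linarith
  · rw [e] at h; linarith

/-- **The closed star of `−u` at a FULL-reader end ball is occupied**: for `b = q + G u` with `q ∈ X` FULL, every slot `w` with `⟪w, −u⟫ > 0` has `b + G w ∈ X`
(`w = −u` gives `q`; a neighbour `w` gives the common neighbour `q + G(w + u)` of `b` and `q`). -/
theorem star_occupied_of_full_reader (G : EuclideanSpace ℝ (Fin 3) ≃ₗᵢ[ℝ] EuclideanSpace ℝ (Fin 3)) {b q u : EuclideanSpace ℝ (Fin 3)} (hq : q ∈ X)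
    (hu : u ∈ fccSlots) (hfull : IsFull X G q) (hbq : b = q + G u) : ∀ w ∈ fccSlots, 0 < ⟪w, -u⟫_ℝ → b + G w ∈ X := by
  intro w hw hpos
  have hnu : -u ∈ fccSlots := neg_mem_fccSlots hu
  rcases eq_or_inner_eq_half_of_inner_pos hw hnu hpos with h | h
  · rw [h, hbq, map_neg, add_neg_cancel_right]; exact hq
  · have hs : w - -u ∈ fccSlots := sub_mem_fccSlots_of_inner_eq_half hw hnu h
    have e : b + G w = q + G (w - -u) := by rw [hbq, sub_neg_eq_add, map_add]; abel
    rw [e]; exact hfull _ hs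

/-- **A slot position is never a mirror position**: for a menu normal `n` of `G` and slots `w, w'` with `⟪G w', n⟫ < 0`, `G w ≠ G w' − 2⟪G w', n⟫ n`
(the two would differ by `2√(2/3)·n`, of squared length `8/3`, while distinct slots differ by squared length `1, 2, 3` or `4` and equal ones by `0`). -/
theorem slot_ne_mirror (G : EuclideanSpace ℝ (Fin 3) ≃ₗᵢ[ℝ] EuclideanSpace ℝ (Fin 3)) {n : EuclideanSpace ℝ (Fin 3)} (hn : IsMenuNormal G n)
    {w w' : EuclideanSpace ℝ (Fin 3)} (hw : w ∈ fccSlots) (hw' : w' ∈ fccSlots) (hlt : ⟪G w', n⟫_ℝ < 0) :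
    G w ≠ G w' - (2 * ⟪G w', n⟫_ℝ) • n := by
  intro h
  have hnn : ⟪n, n⟫_ℝ = 1 := by rw [real_inner_self_eq_norm_sq, hn.1, one_pow]
  have hneg : ⟪G w', n⟫_ℝ = -Real.sqrt (2 / 3) := by
    rcases hn.2 w' hw' with e | e | e
    · rw [e] at hlt; exact absurd hlt (lt_irrefl 0)
    · rw [e] at hlt; exact absurd hlt (not_lt.2 (Real.sqrt_nonneg _))
    · exact e
  have h23 : Real.sqrt (2 / 3) ^ 2 = 2 / 3 := Real.sq_sqrt (by norm_num)
  -- squared distance between the two slot images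
  have hd : ‖G w - G w'‖ ^ 2 = 8 / 3 := by
    have e : G w - G w' = -((2 * ⟪G w', n⟫_ℝ) • n) := by rw [h]; abel
    rw [e, norm_neg, norm_smul, hn.1, mul_one, Real.norm_eq_abs, sq_abs, hneg]; nlinarith [h23]
  have hd' : ‖G w - G w'‖ ^ 2 = 2 - 2 * ⟪w, w'⟫_ℝ := by
    rw [← map_sub, LinearIsometryEquiv.norm_map, norm_sub_sq_real, norm_eq_one_of_mem_fccSlots hw, norm_eq_one_of_mem_fccSlots hw']; ring
  rcases inner_slots_mem hw hw' with e | e | e | e | e <;> rw [hd', e] at hd <;> norm_num at hd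

open scoped Classical in
/-- **A FULL-READER END BALL HAS AT MOST ELEVEN CONTACTS** (under E1).  `X` `1`-separated; `q ∈ X` FULL in the frame `G`; `u` a slot; `b = q + G u` NOT moving in the
class `(G, G u)`.  Then `b` has at most eleven contacts. -/
theorem card_contacts_le_eleven_of_full_end (hE1 : P5Exhaustion) (hX : ∀ p ∈ X, ∀ p' ∈ X, p ≠ p' → 1 ≤ dist p p') {v : WordVersion}
    (G : EuclideanSpace ℝ (Fin 3) ≃ₗᵢ[ℝ] EuclideanSpace ℝ (Fin 3)) {b q u : EuclideanSpace ℝ (Fin 3)} (hq : q ∈ X) (hu : u ∈ fccSlots) (hfull : IsFull X G q)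
    (hbq : b = q + G u) (hnm : ¬ IsMoving X v G (G u) b) : (X.filter fun x => dist b x = 1).card ≤ 11 := by
  have hle := card_filter_dist_eq_one_le_twelve X hX b
  by_contra hgt
  have h12 : (X.filter fun x => dist b x = 1).card = 12 := by omega
  have hstar := star_occupied_of_full_reader G hq hu hfull hbq
  have hnu : -u ∈ fccSlots := neg_mem_fccSlots hu
  set C := X.filter fun x => dist b x = 1 with hC
  have hslot_contact : ∀ {w}, w ∈ fccSlots → b + G w ∈ X → b + G w ∈ C := fun {w} hw hmem =>
    mem_filter.2 ⟨hmem, by rw [dist_eq_norm, sub_add_cancel_left, norm_neg, LinearIsometryEquiv.norm_map, norm_eq_one_of_mem_fccSlots hw]⟩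
  apply hnm
  rcases shell_slots_or_twin_of_star_twelve hE1 G hX hnu hstar h12 with hall | ⟨n, hn, hown, hall⟩
  · -- every contact is a slot ball and there are twelve of them: `b` is FULL
    left
    set I := fccSlots.image fun w => b + G w with hI
    have hCI : C ⊆ I := by
      intro x hx
      obtain ⟨hxX, hxd⟩ := mem_filter.1 hx
      obtain ⟨w, hw, rfl⟩ := hall x hxX hxd
      exact mem_image.2 ⟨w, hw, rfl⟩
    have hIcard : I.card = 12 := card_image_frame G b
    have hIC : I ⊆ C := (eq_of_subset_of_card_le hCI (by rw [hIcard, h12])).symm.subset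
    intro w hw
    exact (mem_filter.1 (hIC (mem_image.2 ⟨w, hw, rfl⟩))).1
  · -- every contact is a twin-dozen member and there are twelve: `b` is TWIN-READING, with `⟪G u, n⟫ ∈ {0, √(2/3)}`
    right; left
    set D := ((fccSlots.filter fun w => ⟪G w, n⟫_ℝ ≤ 0).image fun w => b + G w) ∪
        ((fccSlots.filter fun w => ⟪G w, n⟫_ℝ < 0).image fun w => b + (G w - (2 * ⟪G w, n⟫_ℝ) • n)) with hD
    have hCD : C ⊆ D := by
      intro x hx
      obtain ⟨hxX, hxd⟩ := mem_filter.1 hx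
      exact (mem_twinDozen_iff G n b x).2 (hall x hxX hxd)
    have hDcard : D.card = 12 := card_twinDozen G hn.1 b
    have hDC : D ⊆ C := (eq_of_subset_of_card_le hCD (by rw [hDcard, h12])).symm.subset
    have hmirr : ∀ w ∈ fccSlots, ⟪G w, n⟫_ℝ < 0 → b + (G w - (2 * ⟪G w, n⟫_ℝ) • n) ∈ X := fun w hw hlt =>
      (mem_filter.1 (hDC ((mem_twinDozen_iff G n b _).2 (Or.inr ⟨w, hw, hlt, rfl⟩)))).1
    have hfar : ∀ w ∈ fccSlots, 0 < ⟪G w, n⟫_ℝ → b + G w ∉ X := by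
      intro w hw hpos hmem
      rcases hall _ hmem (mem_filter.1 (hslot_contact hw hmem)).2 with ⟨w', hw', hle', he⟩ | ⟨w', hw', hlt', he⟩
      · have : w = w' := G.injective (add_left_cancel he)
        rw [this] at hpos; linarith
      · exact slot_ne_mirror G hn hw hw' hlt' (add_left_cancel he)
    refine ⟨n, ⟨hn, hown, hmirr, hfar⟩, ?_⟩
    -- the reader `q = b + G(−u)` is a contact at a slot position, hence on the own side: `⟪G(−u), n⟫ ≤ 0`
    have hqC : b + G (-u) ∈ X := hstar (-u) hnu (by rw [real_inner_self_eq_norm_sq, norm_eq_one_of_mem_fccSlots hnu]; norm_num)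
    have hown_u : ⟪G (-u), n⟫_ℝ ≤ 0 := by
      rcases hall _ hqC (mem_filter.1 (hslot_contact hnu hqC)).2 with ⟨w', hw', hle', he⟩ | ⟨w', hw', hlt', he⟩
      · have : -u = w' := G.injective (add_left_cancel he)
        rw [this]; exact hle'
      · exact absurd (add_left_cancel he) (slot_ne_mirror G hn hnu hw' hlt')
    rw [map_neg, inner_neg_left] at hown_u
    rcases hn.2 u hu with e | e | e
    · exact Or.inr e
    · exact Or.inl e
    · rw [e] at hown_u
      have : (0 : ℝ) < Real.sqrt (2 / 3) := Real.sqrt_pos.2 (by norm_num)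
      linarith

open scoped Classical in
/-- **The FULL branch of `IsEndPairA` has `deg b ≤ 11`** (under E1): the data of an (A)-end pair whose mover reads FULL — admissible class `(G, d)` of a slot-rooted
system, `q` FULL, `b = q + d` not moving — force at most eleven contacts at `b`.  So the `deg b = 12` branch of the (L2) split is vacuous at FULL-reader ends. -/
theorem card_contacts_le_eleven_of_isEndPairA_full (hE1 : P5Exhaustion) (hX : ∀ p ∈ X, ∀ p' ∈ X, p ≠ p' → 1 ≤ dist p p') {v : WordVersion}
    {S₁ S₂ : PlateSystem} (h₁ : S₁.RT ⊆ fccSlots) (h₂ : S₂.RT ⊆ fccSlots) {b q : EuclideanSpace ℝ (Fin 3)}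
    {G : EuclideanSpace ℝ (Fin 3) ≃ₗᵢ[ℝ] EuclideanSpace ℝ (Fin 3)} {d : EuclideanSpace ℝ (Fin 3)} (hq : q ∈ X) (hadm : S₁.Adm G d ∨ S₂.Adm G d)
    (hfull : IsFull X G q) (hbq : b = q + d) (hnm : ¬ IsMoving X v G d b) : (X.filter fun x => dist b x = 1).card ≤ 11 := by
  obtain ⟨u, hu, hdu⟩ : ∃ w ∈ fccSlots, d = G w := by
    rcases hadm with h | h
    · exact (exists_slots_of_adm h₁ h).1
    · exact (exists_slots_of_adm h₂ h).1
  subst hdu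
  exact card_contacts_le_eleven_of_full_end hE1 hX G hq hu hfull hbq hnm

end TailResidue

end Summit.Ventures.Crystal3D.Theorems

end
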